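import Mathlib
import HarnessLib

/-!
# Second-order far-field expansion of a Riesz potential (stub `stub_farField_expansion`)

For `Δ > 0`, a real Schwartz function `u` on `ℝ³` with `tsupport u ⊆ closedBall 0 1` and a unit
vector `e`, the Riesz potential `U_u(te) = ∫ u(y) ‖y - te‖^{-2Δ} dy` has the far-field expansion

  `t^{2Δ} U_u(te) = ∫u + (2Δ/t) ∫u⟨e,y⟩ + t^{-2} (2Δ(Δ+1) ∫u⟨e,y⟩² - Δ ∫u‖y‖²) + O(t^{-3})`,

stated as the limit
`t² (t^{2Δ} U_u(te) - ∫u - (2Δ/t)∫u⟨e,y⟩) → 2Δ(Δ+1)∫u⟨e,y⟩² - Δ∫u‖y‖²` (`t → ∞`).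

Mechanism: for `‖y‖ ≤ 1` and `t ≥ 8`, `‖y - te‖² = t²(1 + z)` with `z = -2⟨e,y⟩/t + ‖y‖²/t²`,
`|z| ≤ 3/t ≤ 1/2`, so `t^{2Δ}‖y - te‖^{-2Δ} = (1+z)^{-Δ}`; the scalar third-order Taylor bound
`|(1+z)^{-Δ} - (1 - Δz + (Δ(Δ+1)/2) z²)| ≤ M|z|³` (three applications of the mean value theorem)
then gives a pointwise bound `C/t` for the integrand of the difference, integrated against the
integrable `u`.
-/

noncomputable section

namespace Summit.CriticalPhenomena.Ising3DConformalLimit.Cruxes.GaussianLimitIsFree.Birth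

open MeasureTheory Filter Set Topology

/-- **Third-order Taylor bound for `s ↦ (1+s)^{-Δ}` on `|s| ≤ 1/2`**: there is `M ≥ 0` with
`|(1+s)^{-Δ} - (1 - Δs + (Δ(Δ+1)/2) s²)| ≤ M |s|³`.  Proof: three applications of the mean value
theorem to `g₀ = (1+·)^{-Δ} - P₂`, whose first two derivatives vanish at `0` and whose third
derivative is bounded by `Δ(Δ+1)(Δ+2)·2^{Δ+3}` on `[-1/2, 1/2]`. [folklore] -/
theorem abs_one_add_rpow_neg_sub_taylor_two_le {Δ : ℝ} (hΔ : 0 < Δ) :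
    ∃ M : ℝ, 0 ≤ M ∧ ∀ s : ℝ, |s| ≤ 1 / 2 →
      |(1 + s) ^ (-Δ) - (1 - Δ * s + Δ * (Δ + 1) / 2 * s ^ 2)| ≤ M * |s| ^ 3 := by
  set M : ℝ := Δ * (Δ + 1) * (Δ + 2) * (1 / 2 : ℝ) ^ (-Δ - 3) with hM
  refine ⟨M, by positivity, fun s hs => ?_⟩
  -- the function and its first three derivatives
  set g₀ : ℝ → ℝ := fun x => (1 + x) ^ (-Δ) - (1 - Δ * x + Δ * (Δ + 1) / 2 * x ^ 2) with hg₀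
  set g₁ : ℝ → ℝ := fun x => -Δ * (1 + x) ^ (-Δ - 1) + Δ - Δ * (Δ + 1) * x with hg₁
  set g₂ : ℝ → ℝ := fun x => Δ * (Δ + 1) * (1 + x) ^ (-Δ - 2) - Δ * (Δ + 1) with hg₂
  set g₃ : ℝ → ℝ := fun x => -(Δ * (Δ + 1) * (Δ + 2)) * (1 + x) ^ (-Δ - 3) with hg₃
  set I : Set ℝ := Set.uIcc (0 : ℝ) s with hI
  have hIabs : ∀ x ∈ I, |x| ≤ |s| := by
    intro x hx
    rcases Set.mem_uIcc.mp hx with ⟨h0, h1⟩ | ⟨h0, h1⟩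
    · rw [abs_of_nonneg h0]
      exact h1.trans (le_abs_self s)
    · rw [abs_of_nonpos h1]
      have := neg_abs_le s
      linarith
  have hge : ∀ x ∈ I, (1 / 2 : ℝ) ≤ 1 + x := by
    intro x hx
    have := hIabs x hx
    have := neg_abs_le x
    linarith
  have hpos : ∀ x ∈ I, 0 < 1 + x := fun x hx => lt_of_lt_of_le (by norm_num) (hge x hx)
  -- derivatives
  have hd₀ : ∀ x ∈ I, HasDerivWithinAt g₀ (g₁ x) I x := by
    intro x hx
    have h1x : 1 + x ≠ 0 := (hpos x hx).ne'
    have hA : HasDerivAt (fun y : ℝ => (1 + y) ^ (-Δ)) (-Δ * (1 + x) ^ (-Δ - 1)) x := by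
      have := ((hasDerivAt_id' x).const_add 1).rpow_const (p := -Δ) (Or.inl h1x)
      exact this.congr_deriv (by ring)
    have hsq : HasDerivAt (fun y : ℝ => y ^ 2) (2 * x) x := by
      simpa using hasDerivAt_pow 2 x
    have hB : HasDerivAt (fun y : ℝ => 1 - Δ * y + Δ * (Δ + 1) / 2 * y ^ 2)
        (-Δ + Δ * (Δ + 1) * x) x := by
      have := (((hasDerivAt_id' x).const_mul Δ).const_sub 1).add
        (hsq.const_mul (Δ * (Δ + 1) / 2))
      exact this.congr_deriv (by ring)
    have := (hA.sub hB).hasDerivWithinAt (s := I)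
    simp only [hg₀, hg₁]
    exact this.congr_deriv (by ring)
  have hd₁ : ∀ x ∈ I, HasDerivWithinAt g₁ (g₂ x) I x := by
    intro x hx
    have h1x : 1 + x ≠ 0 := (hpos x hx).ne'
    have hA : HasDerivAt (fun y : ℝ => (1 + y) ^ (-Δ - 1)) ((-Δ - 1) * (1 + x) ^ (-Δ - 2)) x := by
      have := ((hasDerivAt_id' x).const_add 1).rpow_const (p := -Δ - 1) (Or.inl h1x)
      refine this.congr_deriv ?_
      rw [show -Δ - 1 - 1 = -Δ - 2 by ring]
      ring
    have := (((hA.const_mul (-Δ)).add_const Δ).sub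
      ((hasDerivAt_id' x).const_mul (Δ * (Δ + 1)))).hasDerivWithinAt (s := I)
    simp only [hg₁, hg₂]
    exact this.congr_deriv (by ring)
  have hd₂ : ∀ x ∈ I, HasDerivWithinAt g₂ (g₃ x) I x := by
    intro x hx
    have h1x : 1 + x ≠ 0 := (hpos x hx).ne'
    have hA : HasDerivAt (fun y : ℝ => (1 + y) ^ (-Δ - 2)) ((-Δ - 2) * (1 + x) ^ (-Δ - 3)) x := by
      have := ((hasDerivAt_id' x).const_add 1).rpow_const (p := -Δ - 2) (Or.inl h1x)
      refine this.congr_deriv ?_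
      rw [show -Δ - 2 - 1 = -Δ - 3 by ring]
      ring
    have := ((hA.const_mul (Δ * (Δ + 1))).sub_const (Δ * (Δ + 1))).hasDerivWithinAt (s := I)
    simp only [hg₂, hg₃]
    exact this.congr_deriv (by ring)
  -- bound on the third derivative
  have hb₃ : ∀ x ∈ I, ‖g₃ x‖ ≤ M := by
    intro x hx
    have hrp : (1 + x) ^ (-Δ - 3) ≤ (1 / 2 : ℝ) ^ (-Δ - 3) :=
      Real.rpow_le_rpow_of_nonpos (by norm_num) (hge x hx) (by linarith)
    have hrp0 : 0 ≤ (1 + x) ^ (-Δ - 3) := Real.rpow_nonneg (hpos x hx).le _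
    have hD : 0 ≤ Δ * (Δ + 1) * (Δ + 2) := by positivity
    have : ‖g₃ x‖ = Δ * (Δ + 1) * (Δ + 2) * (1 + x) ^ (-Δ - 3) := by
      simp only [hg₃, Real.norm_eq_abs, neg_mul, abs_neg]
      exact abs_of_nonneg (mul_nonneg hD hrp0)
    rw [this, hM]
    exact mul_le_mul_of_nonneg_left hrp hD
  have hconv : Convex ℝ I := convex_uIcc 0 s
  have h0I : (0 : ℝ) ∈ I := Set.left_mem_uIcc
  have hsI : s ∈ I := Set.right_mem_uIcc
  -- first integration: |g₂ x| ≤ M |s|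
  have hb₂ : ∀ x ∈ I, ‖g₂ x‖ ≤ M * |s| := by
    intro x hx
    have h := hconv.norm_image_sub_le_of_norm_hasDerivWithin_le hd₂ hb₃ h0I hx
    have h20 : g₂ 0 = 0 := by simp [hg₂]
    rw [h20, sub_zero, sub_zero, Real.norm_eq_abs] at h
    calc ‖g₂ x‖ ≤ M * |x| := h
      _ ≤ M * |s| := mul_le_mul_of_nonneg_left (hIabs x hx) (by positivity)
  -- second integration: |g₁ x| ≤ M |s| ^ 2
  have hb₁ : ∀ x ∈ I, ‖g₁ x‖ ≤ M * |s| * |s| := by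
    intro x hx
    have h := hconv.norm_image_sub_le_of_norm_hasDerivWithin_le hd₁ hb₂ h0I hx
    have h10 : g₁ 0 = 0 := by simp [hg₁]
    rw [h10, sub_zero, sub_zero, Real.norm_eq_abs] at h
    calc ‖g₁ x‖ ≤ M * |s| * |x| := h
      _ ≤ M * |s| * |s| := mul_le_mul_of_nonneg_left (hIabs x hx) (by positivity)
  -- third integration
  have h := hconv.norm_image_sub_le_of_norm_hasDerivWithin_le hd₀ hb₁ h0I hsI
  have h00 : g₀ 0 = 0 := by simp [hg₀]
  rw [h00, sub_zero, sub_zero, Real.norm_eq_abs, Real.norm_eq_abs] at h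
  calc |(1 + s) ^ (-Δ) - (1 - Δ * s + Δ * (Δ + 1) / 2 * s ^ 2)| = |g₀ s| := by simp [hg₀]
    _ ≤ M * |s| * |s| * |s| := h
    _ = M * |s| ^ 3 := by ring

/-- **Pointwise remainder bound.**  With `z = -2a/t + n/t²`, `|a| ≤ 1`, `0 ≤ n ≤ 1`, `t ≥ 8` and
the Taylor bound of `abs_one_add_rpow_neg_sub_taylor_two_le` (constant `M`):
`|t²((1+z)^{-Δ} - 1 - 2Δa/t) - (2Δ(Δ+1)a² - Δn)| ≤ (27M + 3Δ(Δ+1))/t`. [folklore] -/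
theorem abs_farField_remainder_le {Δ M : ℝ} (hΔ : 0 < Δ) (hM0 : 0 ≤ M)
    (hM : ∀ s : ℝ, |s| ≤ 1 / 2 →
      |(1 + s) ^ (-Δ) - (1 - Δ * s + Δ * (Δ + 1) / 2 * s ^ 2)| ≤ M * |s| ^ 3)
    {a n t : ℝ} (ha : |a| ≤ 1) (hn0 : 0 ≤ n) (hn : n ≤ 1) (ht : 8 ≤ t) :
    |t ^ 2 * ((1 + (-2 * a / t + n / t ^ 2)) ^ (-Δ) - 1 - 2 * Δ / t * a)
        - (2 * Δ * (Δ + 1) * a ^ 2 - Δ * n)| ≤ (27 * M + 3 * Δ * (Δ + 1)) / t := by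
  have ht0 : 0 < t := by linarith
  set z : ℝ := -2 * a / t + n / t ^ 2 with hz
  have hz_bound : |z| ≤ 3 / t := by
    have h1 : |-2 * a / t| ≤ 2 / t := by
      rw [abs_div, abs_of_pos ht0, abs_mul, div_le_div_iff_of_pos_right ht0]
      have : |(-2 : ℝ)| = 2 := by norm_num
      rw [this]
      linarith
    have h2 : |n / t ^ 2| ≤ 1 / t := by
      rw [abs_of_nonneg (by positivity), div_le_div_iff₀ (by positivity) ht0]
      nlinarith
    calc |z| ≤ |-2 * a / t| + |n / t ^ 2| := abs_add_le _ _
      _ ≤ 2 / t + 1 / t := add_le_add h1 h2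
      _ = 3 / t := by ring
  have hz_half : |z| ≤ 1 / 2 := by
    refine hz_bound.trans ?_
    rw [div_le_div_iff₀ ht0 (by norm_num)]
    linarith
  have key := hM z hz_half
  have hdecomp : t ^ 2 * ((1 + z) ^ (-Δ) - 1 - 2 * Δ / t * a) - (2 * Δ * (Δ + 1) * a ^ 2 - Δ * n)
      = t ^ 2 * ((1 + z) ^ (-Δ) - (1 - Δ * z + Δ * (Δ + 1) / 2 * z ^ 2))
        + (-2 * (Δ * (Δ + 1)) * a * n / t + Δ * (Δ + 1) * n ^ 2 / (2 * t ^ 2)) := by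
    rw [hz]
    field_simp
    ring
  rw [hdecomp]
  have hD : 0 < Δ * (Δ + 1) := by positivity
  have hfirst : |t ^ 2 * ((1 + z) ^ (-Δ) - (1 - Δ * z + Δ * (Δ + 1) / 2 * z ^ 2))|
      ≤ 27 * M / t := by
    have h3 : |z| ^ 3 ≤ (3 / t) ^ 3 := pow_le_pow_left₀ (abs_nonneg z) hz_bound 3
    calc |t ^ 2 * ((1 + z) ^ (-Δ) - (1 - Δ * z + Δ * (Δ + 1) / 2 * z ^ 2))|
        = t ^ 2 * |(1 + z) ^ (-Δ) - (1 - Δ * z + Δ * (Δ + 1) / 2 * z ^ 2)| := by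
          rw [abs_mul, abs_of_nonneg (sq_nonneg t)]
      _ ≤ t ^ 2 * (M * |z| ^ 3) := mul_le_mul_of_nonneg_left key (sq_nonneg t)
      _ ≤ t ^ 2 * (M * (3 / t) ^ 3) := by gcongr
      _ = 27 * M / t := by field_simp; ring
  have hsecond : |-2 * (Δ * (Δ + 1)) * a * n / t + Δ * (Δ + 1) * n ^ 2 / (2 * t ^ 2)|
      ≤ 3 * Δ * (Δ + 1) / t := by
    have h1 : |-2 * (Δ * (Δ + 1)) * a * n / t| ≤ 2 * (Δ * (Δ + 1)) / t := by
      rw [abs_div, abs_of_pos ht0, div_le_div_iff_of_pos_right ht0, abs_mul, abs_mul, abs_mul,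
        abs_of_nonneg hn0, abs_of_pos hD, show |(-2 : ℝ)| = 2 by norm_num]
      have : |a| * n ≤ 1 := by nlinarith [abs_nonneg a]
      nlinarith [abs_nonneg a]
    have h2 : |Δ * (Δ + 1) * n ^ 2 / (2 * t ^ 2)| ≤ Δ * (Δ + 1) / t := by
      rw [abs_of_nonneg (by positivity), div_le_div_iff₀ (by positivity) ht0]
      have hn2 : n ^ 2 ≤ 1 := by nlinarith
      calc Δ * (Δ + 1) * n ^ 2 * t ≤ Δ * (Δ + 1) * 1 * t := by gcongr
        _ ≤ Δ * (Δ + 1) * (2 * t ^ 2) := by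
          rw [mul_one]
          exact mul_le_mul_of_nonneg_left (by nlinarith) hD.le
    calc |-2 * (Δ * (Δ + 1)) * a * n / t + Δ * (Δ + 1) * n ^ 2 / (2 * t ^ 2)|
        ≤ |-2 * (Δ * (Δ + 1)) * a * n / t| + |Δ * (Δ + 1) * n ^ 2 / (2 * t ^ 2)| :=
          abs_add_le _ _
      _ ≤ 2 * (Δ * (Δ + 1)) / t + Δ * (Δ + 1) / t := add_le_add h1 h2
      _ = 3 * Δ * (Δ + 1) / t := by ring
  calc _ ≤ |t ^ 2 * ((1 + z) ^ (-Δ) - (1 - Δ * z + Δ * (Δ + 1) / 2 * z ^ 2))|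
        + |-2 * (Δ * (Δ + 1)) * a * n / t + Δ * (Δ + 1) * n ^ 2 / (2 * t ^ 2)| := abs_add_le _ _
    _ ≤ 27 * M / t + 3 * Δ * (Δ + 1) / t := add_le_add hfirst hsecond
    _ = (27 * M + 3 * Δ * (Δ + 1)) / t := by ring

/-- **Kernel identity.**  For `t > 0` and a unit vector `e`,
`t^{2Δ} ‖y - te‖^{-2Δ} = (1 + z)^{-Δ}` with `z = -2⟨e,y⟩/t + ‖y‖²/t²`
(from `‖y - te‖² = t²(1+z)`). [folklore] -/
theorem rpow_mul_norm_sub_smul_rpow_eq {Δ t : ℝ} (ht : 0 < t)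
    {e : EuclideanSpace ℝ (Fin 3)} (he : ‖e‖ = 1) (y : EuclideanSpace ℝ (Fin 3)) :
    t ^ (2 * Δ) * ‖y - t • e‖ ^ (-(2 * Δ)) =
      (1 + (-2 * inner ℝ e y / t + ‖y‖ ^ 2 / t ^ 2)) ^ (-Δ) := by
  have hsq : ‖y - t • e‖ ^ 2 = t ^ 2 * (1 + (-2 * inner ℝ e y / t + ‖y‖ ^ 2 / t ^ 2)) := by
    rw [norm_sub_sq_real, real_inner_smul_right, norm_smul, Real.norm_eq_abs, abs_of_pos ht, he,
      real_inner_comm]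
    field_simp
    ring
  have hpos : 0 ≤ 1 + (-2 * inner ℝ e y / t + ‖y‖ ^ 2 / t ^ 2) := by
    have h := sq_nonneg ‖y - t • e‖
    rw [hsq] at h
    exact nonneg_of_mul_nonneg_right h (by positivity)
  have h1 : ‖y - t • e‖ ^ (-(2 * Δ)) = (‖y - t • e‖ ^ 2) ^ (-Δ) := by
    rw [show (-(2 * Δ) : ℝ) = ((2 : ℕ) : ℝ) * (-Δ) by push_cast; ring,
      Real.rpow_natCast_mul (norm_nonneg _)]
  have h2 : t ^ (2 * Δ) * (t ^ 2) ^ (-Δ) = 1 := by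
    rw [← Real.rpow_natCast_mul ht.le, ← Real.rpow_add ht]
    push_cast
    rw [show 2 * Δ + 2 * -Δ = (0 : ℝ) by ring, Real.rpow_zero]
  rw [h1, hsq, Real.mul_rpow (by positivity) hpos, ← mul_assoc, h2, one_mul]

/-- **Integrability against a test function supported in the unit ball.**  If `u` is Schwartz with
`tsupport u ⊆ closedBall 0 1` and `φ` is a.e.-strongly measurable with `|φ| ≤ B` on the closed unit
ball, then `u · φ` is integrable (it is dominated by `B‖u‖`). [folklore] -/
theorem integrable_schwartz_mul_of_bound (u : SchwartzMap (EuclideanSpace ℝ (Fin 3)) ℝ)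
    (hu : tsupport ⇑u ⊆ Metric.closedBall (0 : EuclideanSpace ℝ (Fin 3)) 1)
    {φ : EuclideanSpace ℝ (Fin 3) → ℝ} (hφ : AEStronglyMeasurable φ volume) {B : ℝ}
    (hB : ∀ y, ‖y‖ ≤ 1 → |φ y| ≤ B) :
    Integrable (fun y => u y * φ y) := by
  have hI : Integrable (fun y => u y) := u.integrable
  refine Integrable.mono' (hI.norm.mul_const B) (u.continuous.aestronglyMeasurable.mul hφ) ?_
  refine Eventually.of_forall fun y => ?_
  by_cases hy : ‖y‖ ≤ 1
  · rw [norm_mul]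
    exact mul_le_mul_of_nonneg_left (hB y hy) (norm_nonneg _)
  · have h0 : u y = 0 :=
      image_eq_zero_of_notMem_tsupport fun h => hy (mem_closedBall_zero_iff.mp (hu h))
    simp [h0]

/-- The auxiliary quantity `z = -2a/t + n/t²` satisfies `1/2 ≤ 1 + z` for `|a| ≤ 1`, `0 ≤ n`,
`t ≥ 8`. [folklore] -/
theorem half_le_one_add_aux {a n t : ℝ} (ha : |a| ≤ 1) (hn0 : 0 ≤ n) (ht : 8 ≤ t) :
    (1 / 2 : ℝ) ≤ 1 + (-2 * a / t + n / t ^ 2) := by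
  have ht0 : 0 < t := by linarith
  have h1 : |-2 * a / t| ≤ 2 / t := by
    rw [abs_div, abs_of_pos ht0, abs_mul, div_le_div_iff_of_pos_right ht0]
    have : |(-2 : ℝ)| = 2 := by norm_num
    rw [this]
    linarith
  have h2 : 0 ≤ n / t ^ 2 := by positivity
  have h3 : 2 / t ≤ 1 / 2 := by
    rw [div_le_div_iff₀ ht0 (by norm_num)]
    linarith
  have h4 := neg_abs_le (-2 * a / t)
  linarith

/-- **Second-order far-field expansion of a Riesz potential** (stub `stub_farField_expansion` of
the line `registered` for the crux `GaussianLimitIsFree`).  For `Δ > 0`, a real Schwartz `u` with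
`tsupport u ⊆ closedBall 0 1` and a unit vector `e`:
`t² · (t^{2Δ} U_u(te) − ∫u − (2Δ/t)∫u⟨e,y⟩) → 2Δ(Δ+1)∫u⟨e,y⟩² − Δ∫u‖y‖²` as `t → ∞`, where
`U_u(te) = ∫ u(y)‖y − te‖^{-2Δ}dy`.  Mechanism: for `‖y‖ ≤ 1 ≤ t/8`,
`t^{2Δ}‖y − te‖^{-2Δ} = (1+z)^{-Δ}`, `z = −2⟨e,y⟩/t + ‖y‖²/t²`, and
`|(1+z)^{-Δ} − 1 + Δz − (Δ(Δ+1)/2)z²| ≤ M|z|³` for `|z| ≤ 1/2` (Taylor), integrated against the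
compactly supported `u`: the difference is `∫ u(y) R_t(y) dy` with `|R_t| ≤ C/t` on the support.
[folklore] -/
theorem stub_farField_expansion :
    ∀ Δ : ℝ, 0 < Δ → ∀ u : SchwartzMap (EuclideanSpace ℝ (Fin 3)) ℝ,
      tsupport ⇑u ⊆ Metric.closedBall (0 : EuclideanSpace ℝ (Fin 3)) 1 →
      ∀ e : EuclideanSpace ℝ (Fin 3), ‖e‖ = 1 →
        Filter.Tendsto
          (fun t : ℝ => t ^ 2 * (t ^ (2 * Δ) * (∫ y, u y * ‖y - t • e‖ ^ (-(2 * Δ))) - (∫ y, u y)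
              - (2 * Δ / t) * ∫ y, u y * inner ℝ e y))
          Filter.atTop
          (nhds (2 * Δ * (Δ + 1) * (∫ y, u y * (inner ℝ e y) ^ 2) - Δ * ∫ y, u y * ‖y‖ ^ 2)) := by
  intro Δ hΔ u hu e he
  obtain ⟨M, hM0, hM⟩ := abs_one_add_rpow_neg_sub_taylor_two_le hΔ
  -- pointwise facts on the support of `u`
  have ha : ∀ y : EuclideanSpace ℝ (Fin 3), ‖y‖ ≤ 1 → |inner ℝ e y| ≤ 1 := by
    intro y hy
    calc |inner ℝ e y| ≤ ‖e‖ * ‖y‖ := abs_real_inner_le_norm e y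
      _ ≤ 1 * 1 := by rw [he]; exact mul_le_mul_of_nonneg_left hy zero_le_one
      _ = 1 := one_mul 1
  have hn : ∀ y : EuclideanSpace ℝ (Fin 3), ‖y‖ ≤ 1 → ‖y‖ ^ 2 ≤ 1 := fun y hy =>
    pow_le_one₀ (norm_nonneg y) hy
  have hzero : ∀ y : EuclideanSpace ℝ (Fin 3), ¬‖y‖ ≤ 1 → u y = 0 := fun y hy =>
    image_eq_zero_of_notMem_tsupport fun h => hy (mem_closedBall_zero_iff.mp (hu h))
  -- integrability of the moments
  have hca : Continuous fun y : EuclideanSpace ℝ (Fin 3) => inner ℝ e y :=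
    continuous_const.inner continuous_id
  have hI0 : Integrable (fun y => u y) := u.integrable
  have hI1 : Integrable (fun y => u y * inner ℝ e y) :=
    integrable_schwartz_mul_of_bound u hu hca.aestronglyMeasurable ha
  have hI2 : Integrable (fun y => u y * (inner ℝ e y) ^ 2) :=
    integrable_schwartz_mul_of_bound u hu (hca.pow 2).aestronglyMeasurable fun y hy => by
      rw [abs_pow]
      exact pow_le_one₀ (abs_nonneg _) (ha y hy)
  have hI3 : Integrable (fun y => u y * ‖y‖ ^ 2) :=
    integrable_schwartz_mul_of_bound u hu (continuous_norm.pow 2).aestronglyMeasurable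
      fun y hy => by
        rw [abs_of_nonneg (sq_nonneg _)]
        exact hn y hy
  -- integrability of the rescaled kernel, `t ≥ 8`
  have hIK : ∀ t : ℝ, 8 ≤ t → Integrable
      (fun y => u y * (1 + (-2 * inner ℝ e y / t + ‖y‖ ^ 2 / t ^ 2)) ^ (-Δ)) := by
    intro t ht
    have hmeas : Measurable
        fun y : EuclideanSpace ℝ (Fin 3) => (1 + (-2 * inner ℝ e y / t + ‖y‖ ^ 2 / t ^ 2)) ^ (-Δ) := by
      fun_prop
    refine integrable_schwartz_mul_of_bound u hu hmeas.aestronglyMeasurable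
      (B := (1 / 2 : ℝ) ^ (-Δ)) fun y hy => ?_
    have hge := half_le_one_add_aux (ha y hy) (sq_nonneg ‖y‖) ht
    rw [abs_of_nonneg (Real.rpow_nonneg (le_trans (by norm_num) hge) _)]
    exact Real.rpow_le_rpow_of_nonpos (by norm_num) hge (by linarith)
  -- main estimate: for `t ≥ 8` the difference is `∫ u R_t` with `|R_t| ≤ C/t` on the support
  have hmain : ∀ t : ℝ, 8 ≤ t →
      ‖t ^ 2 * (t ^ (2 * Δ) * (∫ y, u y * ‖y - t • e‖ ^ (-(2 * Δ))) - (∫ y, u y)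
          - (2 * Δ / t) * ∫ y, u y * inner ℝ e y)
        - (2 * Δ * (Δ + 1) * (∫ y, u y * (inner ℝ e y) ^ 2) - Δ * ∫ y, u y * ‖y‖ ^ 2)‖
        ≤ ((27 * M + 3 * Δ * (Δ + 1)) * ∫ y, ‖u y‖) / t := by
    intro t ht
    have ht0 : 0 < t := by linarith
    -- kernel rewrite
    have hK : t ^ (2 * Δ) * (∫ y, u y * ‖y - t • e‖ ^ (-(2 * Δ)))
        = ∫ y, u y * (1 + (-2 * inner ℝ e y / t + ‖y‖ ^ 2 / t ^ 2)) ^ (-Δ) := by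
      rw [← integral_const_mul]
      refine integral_congr_ae ?_
      filter_upwards with y
      rw [mul_left_comm, rpow_mul_norm_sub_smul_rpow_eq ht0 he y]
    -- linearity
    have hA : Integrable (fun y => t ^ 2 *
        (u y * (1 + (-2 * inner ℝ e y / t + ‖y‖ ^ 2 / t ^ 2)) ^ (-Δ) - u y
          - 2 * Δ / t * (u y * inner ℝ e y))) :=
      (((hIK t ht).sub hI0).sub (hI1.const_mul (2 * Δ / t))).const_mul (t ^ 2)
    have hA1 : Integrable (fun y =>
        u y * (1 + (-2 * inner ℝ e y / t + ‖y‖ ^ 2 / t ^ 2)) ^ (-Δ) - u y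
          - 2 * Δ / t * (u y * inner ℝ e y)) :=
      ((hIK t ht).sub hI0).sub (hI1.const_mul (2 * Δ / t))
    have hA2 : Integrable (fun y =>
        u y * (1 + (-2 * inner ℝ e y / t + ‖y‖ ^ 2 / t ^ 2)) ^ (-Δ) - u y) :=
      (hIK t ht).sub hI0
    have hA3 : Integrable (fun y => 2 * Δ / t * (u y * inner ℝ e y)) := hI1.const_mul _
    have hB : Integrable (fun y =>
        2 * Δ * (Δ + 1) * (u y * (inner ℝ e y) ^ 2) - Δ * (u y * ‖y‖ ^ 2)) :=
      (hI2.const_mul _).sub (hI3.const_mul _)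
    have hB1 : Integrable (fun y => 2 * Δ * (Δ + 1) * (u y * (inner ℝ e y) ^ 2)) :=
      hI2.const_mul _
    have hB2 : Integrable (fun y => Δ * (u y * ‖y‖ ^ 2)) := hI3.const_mul _
    have hid : t ^ 2 * (t ^ (2 * Δ) * (∫ y, u y * ‖y - t • e‖ ^ (-(2 * Δ))) - (∫ y, u y)
          - (2 * Δ / t) * ∫ y, u y * inner ℝ e y)
        - (2 * Δ * (Δ + 1) * (∫ y, u y * (inner ℝ e y) ^ 2) - Δ * ∫ y, u y * ‖y‖ ^ 2)
        = ∫ y, u y * (t ^ 2 * ((1 + (-2 * inner ℝ e y / t + ‖y‖ ^ 2 / t ^ 2)) ^ (-Δ) - 1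
            - 2 * Δ / t * inner ℝ e y) - (2 * Δ * (Δ + 1) * (inner ℝ e y) ^ 2 - Δ * ‖y‖ ^ 2)) := by
      have e1 : ∫ y, u y * (t ^ 2 * ((1 + (-2 * inner ℝ e y / t + ‖y‖ ^ 2 / t ^ 2)) ^ (-Δ) - 1
            - 2 * Δ / t * inner ℝ e y) - (2 * Δ * (Δ + 1) * (inner ℝ e y) ^ 2 - Δ * ‖y‖ ^ 2))
          = ∫ y, (t ^ 2 * (u y * (1 + (-2 * inner ℝ e y / t + ‖y‖ ^ 2 / t ^ 2)) ^ (-Δ) - u y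
              - 2 * Δ / t * (u y * inner ℝ e y))
            - (2 * Δ * (Δ + 1) * (u y * (inner ℝ e y) ^ 2) - Δ * (u y * ‖y‖ ^ 2))) := by
        refine integral_congr_ae ?_
        filter_upwards with y
        ring
      rw [e1, integral_sub hA hB, integral_const_mul, integral_sub hA2 hA3, integral_sub (hIK t ht) hI0,
        integral_const_mul, integral_sub hB1 hB2, integral_const_mul, integral_const_mul, hK]
    -- bound
    rw [hid]
    have hbound : ∀ y : EuclideanSpace ℝ (Fin 3),
        ‖u y * (t ^ 2 * ((1 + (-2 * inner ℝ e y / t + ‖y‖ ^ 2 / t ^ 2)) ^ (-Δ) - 1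
          - 2 * Δ / t * inner ℝ e y) - (2 * Δ * (Δ + 1) * (inner ℝ e y) ^ 2 - Δ * ‖y‖ ^ 2))‖
          ≤ (27 * M + 3 * Δ * (Δ + 1)) / t * ‖u y‖ := by
      intro y
      by_cases hy : ‖y‖ ≤ 1
      · rw [norm_mul, mul_comm]
        refine mul_le_mul_of_nonneg_right ?_ (norm_nonneg _)
        rw [Real.norm_eq_abs]
        exact abs_farField_remainder_le hΔ hM0 hM (ha y hy) (sq_nonneg _) (hn y hy) ht
      · rw [hzero y hy]
        simp
    calc _ ≤ ∫ y, (27 * M + 3 * Δ * (Δ + 1)) / t * ‖u y‖ :=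
          norm_integral_le_of_norm_le (hI0.norm.const_mul _) (Eventually.of_forall hbound)
      _ = ((27 * M + 3 * Δ * (Δ + 1)) * ∫ y, ‖u y‖) / t := by
          rw [integral_const_mul]
          ring
  -- conclusion: squeeze
  rw [tendsto_iff_norm_sub_tendsto_zero]
  refine squeeze_zero' (Eventually.of_forall fun t => norm_nonneg _)
    ((eventually_ge_atTop 8).mono fun t ht => hmain t ht) ?_
  exact tendsto_const_nhds.div_atTop tendsto_id

end Summit.CriticalPhenomena.Ising3DConformalLimit.Cruxes.GaussianLimitIsFree.Birth
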